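import Literature.NumberTheory.LFunctions.DirichletLTruncationPackedLeafData
import Literature.NumberTheory.LFunctions.DirichletLTruncationPackedLeafDBound
import HarnessLib

/-!
# Packed truncation certificates — one cell on one leaf (`leafCell_spec`)

Assembly of the landed pieces at the level of one leaf and one cell: if `leafCell` returns `some (pref', d')` from a state
satisfying the per-cell invariant at `n₀` (and the four chain enclosures hold at `s = i/E`), then the invariant holds at `n₀ + L`:
the A-part by `leaf_A_term` summed over the leaf (the integer `ΔA` of `leafCell` is that sum in closed form, by the leaf
statistics `leafData_*`), the D-part by `leafV_eq` / `leaf_negsum_eq` (packed extraction) and `leaf_D_bound` (analysis).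
[cite: Chua2005RealZeros, §2.2 ALGO 1]
-/

namespace Literature.NumberTheory.LFunctions

namespace LTruncationPacked

open Finset FeketePolyaKernel LTruncationCert LTruncation Literature.Analysis.Convolution

section LeafCellSpec

variable {v : ℕ → ℤ}

/-- `bif c then some x else none = some y` forces `c` and `x = y`. [folklore] -/
private theorem bif_some {α : Type*} {c : Bool} {x y : α} (h : (bif c then some x else none) = some y) :
    c = true ∧ x = y := by
  cases c <;> simp_all

/-- Rounding up: `A/B ≤ ⌈A/B⌉`. [folklore] -/
private theorem le_ceilDiv' {A B : ℕ} (hB : 0 < B) : (A : ℝ) / B ≤ (((A + B - 1) / B : ℕ) : ℝ) := by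
  have h := Nat.div_add_mod (A + B - 1) B
  have hlt := Nat.mod_lt (A + B - 1) hB
  have hA : A ≤ B * ((A + B - 1) / B) := by omega
  rw [div_le_iff₀ (by exact_mod_cast hB)]
  have : (A : ℝ) ≤ ((B * ((A + B - 1) / B) : ℕ) : ℝ) := by exact_mod_cast hA
  push_cast at this; linarith

/-- Splitting `A` at `n₀ − 1` over a whole leaf. [folklore] -/
private theorem Asum_leaf {s : ℝ} {n₀ L : ℕ} (hn₀ : 1 ≤ n₀) (hL : 1 ≤ L) :
    Asum v s (n₀ + L - 1) = Asum v s (n₀ - 1) + ∑ j ∈ range L, (v (n₀ + j) : ℝ) * ((n₀ + j : ℕ) : ℝ) ^ (-s) := by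
  rw [Asum, Asum, show n₀ + L - 1 = (n₀ - 1) + L by omega, Finset.sum_range_add]
  congr 1
  refine Finset.sum_congr rfl fun j _ => ?_
  rw [show n₀ - 1 + j + 1 = n₀ + j by omega]

/-- The closed form of the A-part: `Σ_t (sgnP_t·lowW_t − sgnM_t (c0h − tδ)) = (cp·cml + σf·mL − σc·mR) − (cm·c0h − δ·mm)`. [folklore] -/
private theorem sum_A_closed (L cml σf σc tm c0h δ : ℕ) (dP dM : ℕ → ℕ) :
    ∑ t ∈ range L, ((dP t : ℝ) * lowW cml σf σc tm t - (dM t : ℝ) * ((c0h : ℝ) - t * (δ : ℝ))) =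
      (((∑ t ∈ range L, dP t) * cml + σf * ∑ t ∈ range L, (if t ≤ tm then tm - t else 0) * dP t : ℕ) : ℝ)
        - ((σc * ∑ t ∈ range L, (if tm < t then t - tm else 0) * dP t : ℕ) : ℝ)
        - ((((∑ t ∈ range L, dM t) * c0h : ℕ) : ℝ) - ((δ * ∑ t ∈ range L, t * dM t : ℕ) : ℝ)) := by
  push_cast
  rw [Finset.sum_mul, Finset.mul_sum, Finset.mul_sum, Finset.sum_mul, Finset.mul_sum, ← Finset.sum_add_distrib,
    ← Finset.sum_sub_distrib, ← Finset.sum_sub_distrib, ← Finset.sum_sub_distrib]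
  refine Finset.sum_congr rfl fun t _ => ?_
  rw [lowW]
  split_ifs with h1 h2 h2
  · omega
  · ring
  · ring
  · omega

/-- Unpacking a successful `leafCell` step: the range checks and the formula for `pref'` (the `d'` formula is read off the
definition in the same way by the D-part). [cite: Chua2005RealZeros, §2.2 ALGO 1] -/
theorem leafCell_some {b P E i c0l c0h c1h cml : ℕ} {ld : LeafData} {pref pref' : ℤ} {d d' : ℕ}
    (h : leafCell b P E ld i c0l c0h c1h cml pref d = some (pref', d')) :
    (i ≤ E ∧ pref.natAbs < 2 ^ (P + 15) ∧ c0h < 2 ^ (P + 2) ∧ cml < 2 ^ (P + 2) ∧ ld.L < 2 ^ 12 ∧ P + 30 ≤ b ∧ 1 ≤ ld.n0) ∧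
    pref' = pref + (((ld.cp * cml + (i * cml) / (E * (ld.n0 + ld.tm)) * ld.mL : ℕ) : ℤ)
      - (((i * cml + E * (ld.n0 + ld.tm) - 1) / (E * (ld.n0 + ld.tm)) * ld.mR : ℕ) : ℤ)
      - (((ld.cm * c0h : ℕ) : ℤ) - (((if ld.L ≤ 1 then 0 else (c0l - c1h) / (ld.L - 1)) * ld.mm : ℕ) : ℤ))) := by
  obtain ⟨hok, hxy⟩ := bif_some (by simpa only [leafCell] using h)
  simp only [Bool.and_eq_true, Nat.ble_eq, Nat.blt_eq, Nat.one_shiftLeft,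
    show P + 16 - 1 = P + 15 by omega] at hok
  obtain ⟨⟨⟨⟨⟨⟨hiE, hprefb⟩, hc0hb⟩, hcmlb⟩, hLb⟩, hPb⟩, hn0⟩ := hok
  simp only [Prod.mk.injEq] at hxy
  obtain ⟨hpref', -⟩ := hxy
  exact ⟨⟨hiE, hprefb, hc0hb, hcmlb, hLb, hPb, hn0⟩, hpref'.symm⟩

/-- **One cell on one leaf: the A-part.** [cite: Chua2005RealZeros, §2.2 ALGO 1] -/
theorem leafCell_spec_A {b P E J n₀ L i c0l c0h c1h cml : ℕ} (hv : ∀ n, v n = 0 ∨ v n = 1 ∨ v n = -1)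
    (hE : 1 ≤ E) (hn₀ : 1 ≤ n₀) (hL1 : 1 ≤ L)
    (hc0l : (c0l : ℝ) ≤ (2 : ℝ) ^ P * (n₀ : ℝ) ^ (-((i : ℝ) / E)))
    (hc0h : (2 : ℝ) ^ P * (n₀ : ℝ) ^ (-((i : ℝ) / E)) ≤ c0h)
    (hc1h : (2 : ℝ) ^ P * ((n₀ + L - 1 : ℕ) : ℝ) ^ (-((i : ℝ) / E)) ≤ c1h)
    (hcml : (cml : ℝ) ≤ (2 : ℝ) ^ P * ((n₀ + (L - 1) / 2 : ℕ) : ℝ) ^ (-((i : ℝ) / E)))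
    {pref : ℤ} {d : ℕ} (hinvA : (pref : ℝ) ≤ (2 : ℝ) ^ P * Asum v ((i : ℝ) / E) (n₀ - 1)) {pref' : ℤ} {d' : ℕ}
    (h : leafCell b P E (leafData b P J n₀ L (kpack b L (sgnP v n₀)) (kpack b L (sgnM v n₀))) i c0l c0h c1h cml pref d =
      some (pref', d')) :
    (pref' : ℝ) ≤ (2 : ℝ) ^ P * Asum v ((i : ℝ) / E) (n₀ + L - 1) := by
  have hdP : ∀ j, sgnP v n₀ j ≤ 1 := fun j => by rw [sgnP, ind]; split_ifs <;> simp
  have hdM : ∀ j, sgnM v n₀ j ≤ 1 := fun j => by rw [sgnM, ind]; split_ifs <;> simp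
  obtain ⟨⟨hiE, -, -, -, hLb, hPb, -⟩, hpref'⟩ := leafCell_some h
  have hLb' : L < 2 ^ 12 := hLb
  rw [leafData_cp (show 16 ≤ b by omega) hLb' (fun j _ => hdP j),
    leafData_cm (show 16 ≤ b by omega) hLb' (fun j _ => hdM j),
    leafData_mm (show 28 ≤ b by omega) hLb' (fun j _ => hdM j),
    leafData_mL (show 28 ≤ b by omega) hLb' hL1 (fun j _ => hdP j),
    leafData_mR (show 28 ≤ b by omega) hLb' hL1 (fun j _ => hdP j)] at hpref'
  have hfL : (leafData b P J n₀ L (kpack b L (sgnP v n₀)) (kpack b L (sgnM v n₀))).L = L := rfl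
  have hfn : (leafData b P J n₀ L (kpack b L (sgnP v n₀)) (kpack b L (sgnM v n₀))).n0 = n₀ := rfl
  have hftm : (leafData b P J n₀ L (kpack b L (sgnP v n₀)) (kpack b L (sgnM v n₀))).tm = (L - 1) / 2 := rfl
  rw [hfL, hfn, hftm] at hpref'
  -- the termwise bounds, summed, in closed form
  have hterm := fun t (ht : t ∈ range L) =>
    leaf_A_term (P := P) (c0l := c0l) (c0h := c0h) (c1h := c1h) (cml := cml) hv hn₀ hE hiE rfl
      (Finset.mem_range.1 ht) hc0l hc0h hc1h hcml
  have hsum := Finset.sum_le_sum hterm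
  rw [← Finset.mul_sum, sum_A_closed] at hsum
  have hcast : (pref' : ℝ) = (pref : ℝ) +
      ((((∑ t ∈ range L, sgnP v n₀ t) * cml +
          (i * cml) / (E * (n₀ + (L - 1) / 2)) * ∑ t ∈ range L, (if t ≤ (L - 1) / 2 then (L - 1) / 2 - t else 0) * sgnP v n₀ t : ℕ) : ℝ)
        - (((i * cml + E * (n₀ + (L - 1) / 2) - 1) / (E * (n₀ + (L - 1) / 2)) *
            ∑ t ∈ range L, (if (L - 1) / 2 < t then t - (L - 1) / 2 else 0) * sgnP v n₀ t : ℕ) : ℝ)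
        - ((((∑ t ∈ range L, sgnM v n₀ t) * c0h : ℕ) : ℝ) -
            (((if L ≤ 1 then 0 else (c0l - c1h) / (L - 1)) * ∑ t ∈ range L, t * sgnM v n₀ t : ℕ) : ℝ))) := by
    rw [hpref']; simp only [Int.cast_add, Int.cast_sub, Int.cast_natCast]
  rw [hcast, Asum_leaf hn₀ hL1]
  set S := ∑ j ∈ range L, (v (n₀ + j) : ℝ) * ((n₀ + j : ℕ) : ℝ) ^ (-((i : ℝ) / E)) with hS
  have hdist : (2 : ℝ) ^ P * (Asum v ((i : ℝ) / E) (n₀ - 1) + S) =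
      (2 : ℝ) ^ P * Asum v ((i : ℝ) / E) (n₀ - 1) + (2 : ℝ) ^ P * S := by ring
  rw [hdist]
  linarith

/-- **One cell on one leaf: the D-part.** [cite: Chua2005RealZeros, §2.2 ALGO 1] -/
theorem leafCell_spec_D {b P E J n₀ L i c0l c0h c1h cml : ℕ} (hv : ∀ n, v n = 0 ∨ v n = 1 ∨ v n = -1)
    (hE : 1 ≤ E) (hn₀ : 1 ≤ n₀) (hL1 : 1 ≤ L)
    (hc0h : (2 : ℝ) ^ P * (n₀ : ℝ) ^ (-((i : ℝ) / E)) ≤ c0h)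
    (hcml : (cml : ℝ) ≤ (2 : ℝ) ^ P * ((n₀ + (L - 1) / 2 : ℕ) : ℝ) ^ (-((i : ℝ) / E)))
    {pref : ℤ} {d : ℕ} (hinvA : (pref : ℝ) ≤ (2 : ℝ) ^ P * Asum v ((i : ℝ) / E) (n₀ - 1))
    (hinvD : (2 : ℝ) ^ P * Dsum v ((i : ℝ) / E) (n₀ - 1) ≤ d) {pref' : ℤ} {d' : ℕ}
    (h : leafCell b P E (leafData b P J n₀ L (kpack b L (sgnP v n₀)) (kpack b L (sgnM v n₀))) i c0l c0h c1h cml pref d =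
      some (pref', d')) :
    (2 : ℝ) ^ P * Dsum v ((i : ℝ) / E) (n₀ + L - 1) ≤ d' := by
  have hdP : ∀ j, sgnP v n₀ j ≤ 1 := fun j => by rw [sgnP, ind]; split_ifs <;> simp
  have hdM : ∀ j, sgnM v n₀ j ≤ 1 := fun j => by rw [sgnM, ind]; split_ifs <;> simp
  obtain ⟨⟨hiE, hprefb, hc0hb, hcmlb, hLb, hPb, -⟩, -⟩ := leafCell_some h
  have hLb' : L < 2 ^ 12 := hLb
  -- unpack the `d'` formula and rewrite it with the packed identities
  obtain ⟨-, hxy⟩ := bif_some (by simpa only [leafCell] using h)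
  simp only [Prod.mk.injEq] at hxy
  obtain ⟨-, hd'⟩ := hxy
  simp only [show (leafData b P J n₀ L (kpack b L (sgnP v n₀)) (kpack b L (sgnM v n₀))).L = L from rfl,
    show (leafData b P J n₀ L (kpack b L (sgnP v n₀)) (kpack b L (sgnM v n₀))).n0 = n₀ from rfl,
    show (leafData b P J n₀ L (kpack b L (sgnP v n₀)) (kpack b L (sgnM v n₀))).tm = (L - 1) / 2 from rfl,
    leafData_Cp (show 16 ≤ b by omega) hLb' (fun j _ => hdP j),
    leafData_Cm (show 16 ≤ b by omega) hLb' (fun j _ => hdM j), Nat.one_shiftLeft] at hd'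
  set tm := (L - 1) / 2 with htm
  set σc := (i * cml + E * (n₀ + tm) - 1) / (E * (n₀ + tm)) with hσc
  set wlo : ℕ := ((cml : ℤ) - ((L - 1 - tm) * σc : ℕ)).toNat with hwlo
  have hwlo_lt : wlo < 2 ^ (P + 2) := by
    have : wlo ≤ cml := by
      rw [hwlo]
      have : ((cml : ℤ) - ((L - 1 - tm) * σc : ℕ)) ≤ cml := by omega
      omega
    omega
  have hV := leafV_eq (b := b) (L := L) (dP := sgnP v n₀) (dM := sgnM v n₀) (pref := pref) hPb hLb' hdP hdM hprefb hwlo_lt hc0hb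
  have hneg := leaf_negsum_eq (b := b) (L := L) (dP := sgnP v n₀) (dM := sgnM v n₀) (pref := pref) hPb hLb' hdP hdM hprefb
    hwlo_lt hc0hb
  dsimp only at hneg
  rw [hV, hneg] at hd'
  -- the analytic bound
  set s : ℝ := (i : ℝ) / E with hs
  have hx0 : (0 : ℝ) < n₀ := by exact_mod_cast hn₀
  have hs0 : 0 ≤ s := by positivity
  have hs1 : s ≤ 1 := by rw [hs, div_le_one (by exact_mod_cast hE)]; exact_mod_cast hiE
  have hmono : ∀ t < L, (2 : ℝ) ^ P * ((n₀ + t : ℕ) : ℝ) ^ (-s) ≤ c0h := fun t _ => by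
    refine le_trans (mul_le_mul_of_nonneg_left ?_ (by positivity)) hc0h
    exact Real.rpow_le_rpow_of_nonpos hx0 (by exact_mod_cast Nat.le_add_right n₀ t) (neg_nonpos.2 hs0)
  have hwlo_le : ∀ t < L, (wlo : ℝ) ≤ (2 : ℝ) ^ P * ((n₀ + t : ℕ) : ℝ) ^ (-s) := by
    intro t ht
    have hn1 : (2 : ℝ) ^ P * ((n₀ + (L - 1) : ℕ) : ℝ) ^ (-s) ≤ (2 : ℝ) ^ P * ((n₀ + t : ℕ) : ℝ) ^ (-s) := by
      refine mul_le_mul_of_nonneg_left ?_ (by positivity)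
      exact Real.rpow_le_rpow_of_nonpos (by exact_mod_cast (show 0 < n₀ + t by omega))
        (by exact_mod_cast (show n₀ + t ≤ n₀ + (L - 1) by omega)) (neg_nonpos.2 hs0)
    refine le_trans ?_ hn1
    by_cases hneg' : (cml : ℤ) - ((L - 1 - tm) * σc : ℕ) ≤ 0
    · have : wlo = 0 := by rw [hwlo, Int.toNat_eq_zero]; exact hneg'
      rw [this, Nat.cast_zero]; positivity
    · have hwz : (wlo : ℤ) = (cml : ℤ) - ((L - 1 - tm) * σc : ℕ) := by
        rw [hwlo]; exact Int.toNat_of_nonneg (by omega)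
      have hwr : (wlo : ℝ) = (cml : ℝ) - (((L - 1 - tm) * σc : ℕ) : ℝ) := by exact_mod_cast hwz
      rw [hwr]
      have hEm : 0 < E * (n₀ + tm) := Nat.mul_pos (by omega) (by omega)
      have hm : (0 : ℝ) < ((n₀ + tm : ℕ) : ℝ) := by exact_mod_cast (show 0 < n₀ + tm by omega)
      have hsc : s * cml / ((n₀ + tm : ℕ) : ℝ) ≤ (σc : ℝ) := by
        calc s * cml / ((n₀ + tm : ℕ) : ℝ) = ((i * cml : ℕ) : ℝ) / ((E * (n₀ + tm) : ℕ) : ℝ) := by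
              rw [hs]; push_cast; field_simp
          _ ≤ _ := by rw [hσc]; exact le_ceilDiv' hEm
      have key := plus_term_bound (P := P) hs0 hs1 hm (x := ((n₀ + (L - 1) : ℕ) : ℝ))
        (by exact_mod_cast (show 0 < n₀ + (L - 1) by omega)) (Nat.cast_nonneg cml) hcml
      refine le_trans ?_ key
      have hLt : (0 : ℝ) ≤ ((L - 1 - tm : ℕ) : ℝ) := Nat.cast_nonneg _
      have := mul_le_mul_of_nonneg_left hsc hLt
      have hxm : (((n₀ + (L - 1) : ℕ) : ℝ) - ((n₀ + tm : ℕ) : ℝ)) / ((n₀ + tm : ℕ) : ℝ) =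
          ((L - 1 - tm : ℕ) : ℝ) / ((n₀ + tm : ℕ) : ℝ) := by
        rw [Nat.cast_sub (by omega : tm ≤ L - 1)]; push_cast; ring
      rw [hxm, Nat.cast_mul]
      calc (cml : ℝ) - ((L - 1 - tm : ℕ) : ℝ) * (σc : ℝ)
          ≤ (cml : ℝ) - ((L - 1 - tm : ℕ) : ℝ) * (s * cml / ((n₀ + tm : ℕ) : ℝ)) := by linarith
        _ = cml * (1 - s * (((L - 1 - tm : ℕ) : ℝ) / ((n₀ + tm : ℕ) : ℝ))) := by ring
  have hD := leaf_D_bound (P := P) (wlo := wlo) (c0h := c0h) hv hn₀ hinvA hwlo_le hmono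
  have hceil := le_ceilDiv' (A := ∑ t ∈ range L, (-(prefRun pref wlo c0h (sgnP v n₀) (sgnM v n₀) t)).toNat) (B := n₀)
    (by omega)
  rw [← hd']
  push_cast [Nat.cast_sum] at hceil ⊢
  linarith

end LeafCellSpec

end LTruncationPacked

end Literature.NumberTheory.LFunctions
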